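import Summits.QuantumFields.BalabanUV.Beta.MultiscaleGradientL2

/-!
# `Summit.QuantumFields.BalabanUV.Beta.MultiscaleGradientL2Adjoint` — engine file 20d: the ℓ² ADJOINT-GRADIENT MEMBER (3.46)₃'s
# SHAPE for `levelOp` — `‖1_{cell k}(levelOp)⁻¹D*λ‖₂ ≤ √(2(C + d·e²c_max²))·(n_k/μ₀)·e^{4dκ}·e^{−κd_n(t_k,t_{k′})}·‖λ‖₂` for bond
# fields `λ` living on the bonds that start in cell `k′` — for EVERY isometric transport, by TRANSPOSITION of file 20c
# (`(levelOp)⁻¹` is symmetric, `D* = Dᵀ`)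

HONEST FRAMING (page 1 of everything in this cell).  Discharging `FlowStep.BetaPertH` would make Bałaban's ultraviolet
stability UNCONDITIONAL — a constructive-QFT result; it is NOT the continuum limit and NOT the Clay problem.  This module
discharges nothing of `BetaPertH`; it is [folklore] finite-dimensional bookkeeping about the MODEL operator, kernel-checked, by the
OWNER of binder row D4 (unit `b2b-balaban-beta-an4`, gen 46).  HONEST DEPENDENCY: continuum YM on T⁴ ⇐ BetaPertH ∧ nine spine
estimates (0/9 proved); BetaPertH ⇐ (D1) ∧ (D4) ∧ CAP+tail; G-an2-4 gates asym, D1 and NE2/3/4.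

THE POINT (O.2 item (i), MODEL level; NOT the critical path).  [B9] Thm 3.1 (3.46) p. 398 has, next to `‖h∇_UG′(U)λ‖`, the
member `‖hG′(U)∇*_Uλ‖ ≤ B₀L^jη|h|e^{−δ₀d(y,y′)}‖λ‖`; p. 398 remarks «we may always replace ∇_U by ∇*_U, and vice versa».  At MODEL
level the second member IS the transpose of the first: `A = levelOp` is symmetric (`isTransposePair_levelOp`), so is `A⁻¹`
(`B9Thm37GlueSz.isTransposePair_inv`), and `D* = covDT` is the transpose of `D = covD` (`sum_covDT_mul`).  With `F = A⁻¹D*λ` and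
`h = 1_{cell k}·F`: `‖1_{cell k}F‖² = ⟨h, A⁻¹D*λ⟩ = ⟨DA⁻¹h, λ⟩ ≤ ‖1_{bonds of cell k′}DA⁻¹h‖·‖λ‖`, and file 20c bounds the first
factor by `K·n_k·e^{−κd_n(t_{k′},t_k)}·‖h‖` with `‖h‖ = ‖1_{cell k}F‖` — hence **`real_cellAdjGrad_levelOp_inverse_le`**, the
(3.46)₃ SHAPE with ONE power of the scale of the `h`-cell (print's `L^jη`, `y ∈ Λ_j` the `h`-side), every isometric `Rm`, constants
`d, c_max, C, μ₀, κ` only.  WHAT THIS IS NOT: nothing of Bałaban's G′(U)∇*_U; (3.46) is a LOCATOR; row D4 readiness width 0;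
D4 DISCHARGE NO DATE.

WHAT IS CERTIFIED (kernel, 0 sorry, 0 def): `sum_indicator_mul_self`, **`real_cellAdjGrad_levelOp_inverse_le`**.
LOCATORS (shape only; ABSOLUTE RULE — nothing printed is asserted): [Balaban1985BackgroundPropagators] Thm 3.1 (3.46) p. 398,
(3.8) p. 392.  NOT BetaPertH, NOT continuum, NOT Clay, NOT summit progress.
-/

open scoped BigOperators
open Finset

namespace Summit.QuantumFields.BalabanUV.Beta.MultiscaleGradientL2Adjoint

open Summit.QuantumFields.BalabanUV.Beta.BoxPoincare (Box)
open Summit.QuantumFields.BalabanUV.Beta.MultiscaleCoerciveTorus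
open Summit.QuantumFields.BalabanUV.Beta.MultiscaleDistance
open Summit.QuantumFields.BalabanUV.Beta.MultiscaleDistanceMetric (sdist_comm)
open Summit.QuantumFields.BalabanUV.Beta.MultiscaleDecayBudget
open Summit.QuantumFields.BalabanUV.Beta.MultiscaleDecay (decay_levelOp)
open Summit.QuantumFields.BalabanUV.Beta.MultiscaleGradientL2 (real_cellGrad_levelOp_inverse_le)
open Literature.MathematicalPhysics.QuantumFieldTheory.Balaban1983to89
open Literature.MathematicalPhysics.QuantumFieldTheory.Balaban1983to89.B9Thm37Glue (covD covDT sum_covDT_mul IsTransposePair)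
open Literature.MathematicalPhysics.QuantumFieldTheory.Balaban1983to89.B9Thm37GluePU (bsrc btgt)
open Literature.MathematicalPhysics.QuantumFieldTheory.Balaban1983to89.B9Thm37GlueSz (isTransposePair_inv)
open Literature.MathematicalPhysics.QuantumFieldTheory.Balaban1983to89.B9Thm37GlueTorusCov (tblk)
open Literature.MathematicalPhysics.QuantumFieldTheory.Balaban1983to89.B9Thm37GlueTorusCovLevels (levelOp isTransposePair_levelOp)
open Summit.QuantumFields.BalabanUV.T4Continuum.RegionGaugeSliceOrth (le_of_le_sqrt_mul_sqrt)
open B5TorusCover (UT Ctr ctrU)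

noncomputable section

/-! ## §1 The indicator pairing -/

/-- For a {0,1}-indicator-type cut `h = 1_P·F`: `Σ_p h_p·F_p = Σ_{p ∈ P} F_p²`. [folklore] -/
theorem sum_indicator_mul_self {Y : Type*} [Fintype Y] [DecidableEq Y] (P : Finset Y) (F : Y → ℝ) :
    ∑ p, (if p ∈ P then F p else 0) * F p = ∑ p ∈ P, F p ^ 2 := by
  classical
  rw [← Finset.sum_filter_add_sum_filter_not univ (fun p => p ∈ P)]
  have h1 : ∑ p ∈ univ.filter (fun p => p ∈ P), (if p ∈ P then F p else 0) * F p = ∑ p ∈ P, F p ^ 2 := by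
    have : univ.filter (fun p => p ∈ P) = P := by ext p; simp
    rw [this]
    exact Finset.sum_congr rfl fun p hp => by rw [if_pos hp, sq]
  have h2 : ∑ p ∈ univ.filter (fun p => ¬p ∈ P), (if p ∈ P then F p else 0) * F p = 0 :=
    Finset.sum_eq_zero fun p hp => by rw [if_neg (mem_filter.mp hp).2, zero_mul]
  rw [h1, h2, add_zero]

/-! ## §2 THE ADJOINT-GRADIENT MEMBER (3.46)₃'s SHAPE by transposition -/

variable {d : ℕ} {N : Fin d → ℕ} [∀ i, NeZero (N i)] [NeZero d] {Cp J K : Type} [Fintype Cp] [DecidableEq Cp] [Nonempty Cp]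
  [Fintype J] [Fintype K] [DecidableEq K] (S : J → ℕ) (hS : ∀ l, 1 ≤ S l) (hdivS : ∀ l i, S l ∣ N i) (lvl : K → J)
  (zc : (k : K) → Ctr N (S (lvl k)))
  (hdisj : ∀ k k' v v', cellPt S hS hdivS lvl zc k v = cellPt S hS hdivS lvl zc k' v' → k = k')
  (hcover : ∀ x : UT N, ∃ k, ∃ v : Box d (S (lvl k)), cellPt S hS hdivS lvl zc k v = x)
  (Rm : UT N × Fin d → Cp → Cp → ℝ) (hRm : ∀ b i j, ∑ k, Rm b k i * Rm b k j = if i = j then (1 : ℝ) else 0)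
  (T : J → UT N → Cp → Cp → ℝ) (hT : ∀ l x i i', ∑ k, T l x k i * T l x k i' = if i = i' then (1 : ℝ) else 0)
  (a : J → ℝ) (ha : ∀ j, 0 ≤ a j) (ω : J → UT N → ℝ)
  (hsupp : ∀ l x, ω l (ctrU N (S l) (tblk (hS l) (hdivS l) x)) ≠ 0 → ∃ k v, lvl k = l ∧ cellPt S hS hdivS lvl zc k v = x)
  {amax : ℝ} (hamax : 0 ≤ amax)
  (hscale : ∀ k, a (lvl k) * ω (lvl k) (ctrU N (S (lvl k)) (zc k)) ^ 2 * (S (lvl k) : ℝ) ^ d ≤ amax / (S (lvl k) : ℝ) ^ 2)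
  (c : UT N × Fin d → ℝ) {cmax : ℝ} (hc : ∀ b, |c b| ≤ cmax) {C : ℝ}
  (hcoer : ∀ f : UT N × Cp → ℝ,
    C * ∑ k, ((S (lvl k) : ℝ) ^ 2)⁻¹ * ∑ v : Box d (S (lvl k)), ∑ i, f (cellPt S hS hdivS lvl zc k v, i) ^ 2 ≤
      ∑ p, f p * levelOp bsrc btgt c Rm (fun l x => ctrU N (S l) (tblk (hS l) (hdivS l) x))
        (fun l x => ω l (ctrU N (S l) (tblk (hS l) (hdivS l) x))) T a f p)
  {κ : ℝ} (hκ0 : 0 ≤ κ) (hκ1 : κ ≤ 1)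

include hdisj hRm hT ha hsupp hamax hscale hc hcoer hκ0 hκ1

/-- **THE ℓ² ADJOINT-GRADIENT MEMBER (3.46)₃'s SHAPE FOR `levelOp` — EVERY ISOMETRIC TRANSPORT, LEVEL-FREE.**  In the MODEL
setting of `MultiscaleDecay.hc_levelOp` with the margin `μ₀ > 0`, for a bond field `λ` supported on the bonds starting in cell `k′`
and every cell `k`:
`√(Σ_{p : cell k} ((levelOp)⁻¹(D*λ))(p)²) ≤ √(2(C + d·e²·c_max²))·(n_k/μ₀)·e^{4dκ}·e^{−κ·d_n(t_k,t_{k′})}·√(Σ_{b₋ ∈ cell k′}Σ_i λ(b,i)²)`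
— by transposition of file 20c: `A⁻¹` symmetric (`isTransposePair_levelOp` + `isTransposePair_inv`), `D* = Dᵀ` (`sum_covDT_mul`),
`‖1_kF‖² = ⟨DA⁻¹(1_kF), λ⟩ ≤ ‖1_{k′-bonds}DA⁻¹(1_kF)‖‖λ‖` and `real_cellGrad_levelOp_inverse_le` with source cell `k`.
[cite: Balaban1985BackgroundPropagators, Thm 3.1 (3.46) p.398 + (3.8) p.392] [folklore] -/
theorem real_cellAdjGrad_levelOp_inverse_le (hμ : 0 < C - 2 * d * cmax ^ 2 * κ ^ 2 - amax * (Real.exp (2 * d * κ) - 1))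
    (k' : K) (lam : (UT N × Fin d) × Cp → ℝ) (hlam : ∀ q, cellOf S hS hdivS lvl zc hcover (bsrc q.1) ≠ k' → lam q = 0) (k : K) :
    Real.sqrt (∑ p ∈ univ.filter (fun p : UT N × Cp => cellOf S hS hdivS lvl zc hcover p.1 = k),
        ((Ring.inverse (levelOp bsrc btgt c Rm (fun l x => ctrU N (S l) (tblk (hS l) (hdivS l) x))
          (fun l x => ω l (ctrU N (S l) (tblk (hS l) (hdivS l) x))) T a)) (covDT bsrc btgt c Rm lam) p) ^ 2) ≤
      Real.sqrt (2 * (C + d * Real.exp 1 ^ 2 * cmax ^ 2)) *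
        ((S (lvl k) : ℝ) / (C - 2 * d * cmax ^ 2 * κ ^ 2 - amax * (Real.exp (2 * d * κ) - 1))) *
        Real.exp (4 * d * κ) *
        Real.exp (-(κ * sdist bsrc btgt (siteScale S hS hdivS lvl zc hcover)
          (ctrU N (S (lvl k)) (zc k)) (ctrU N (S (lvl k')) (zc k')))) *
        Real.sqrt (∑ b ∈ univ.filter (fun b : UT N × Fin d => cellOf S hS hdivS lvl zc hcover (bsrc b) = k'),
          ∑ i, lam (b, i) ^ 2) := by
  classical
  obtain ⟨i₀⟩ := ‹Nonempty Cp›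
  set μ₀ := C - 2 * d * cmax ^ 2 * κ ^ 2 - amax * (Real.exp (2 * d * κ) - 1) with hμ₀
  set Aop := levelOp bsrc btgt c Rm (fun l x => ctrU N (S l) (tblk (hS l) (hdivS l) x))
    (fun l x => ω l (ctrU N (S l) (tblk (hS l) (hdivS l) x))) T a with hAop
  set n := siteScale S hS hdivS lvl zc hcover with hn
  set tk : UT N := ctrU N (S (lvl k)) (zc k) with htk
  set tk' : UT N := ctrU N (S (lvl k')) (zc k') with htk'
  set F := (Ring.inverse Aop) (covDT bsrc btgt c Rm lam) with hF
  set P := univ.filter (fun p : UT N × Cp => cellOf S hS hdivS lvl zc hcover p.1 = k) with hP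
  set Bd := univ.filter (fun b : UT N × Fin d => cellOf S hS hdivS lvl zc hcover (bsrc b) = k') with hBd
  set h : UT N × Cp → ℝ := fun p => if p ∈ P then F p else 0 with hh
  set Kc : ℝ := Real.sqrt (2 * (C + d * Real.exp 1 ^ 2 * cmax ^ 2)) * ((S (lvl k) : ℝ) / μ₀) * Real.exp (4 * d * κ) *
    Real.exp (-(κ * sdist bsrc btgt n tk tk')) with hKc
  have hKc0 : 0 ≤ Kc := by rw [hKc]; positivity
  -- units and symmetry
  have hunit : IsUnit Aop :=
    (decay_levelOp S hS hdivS lvl zc hdisj hcover Rm hRm T hT a ha ω hsupp hamax hscale c hc hcoer hκ0 hκ1 hμ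
      (tk', i₀) (tk', i₀)).1
  have hmul : Aop * Ring.inverse Aop = 1 := Ring.mul_inverse_cancel _ hunit
  have hsymA : IsTransposePair Aop Aop := by
    rw [hAop]; exact isTransposePair_levelOp bsrc btgt c Rm _ _ T a
  have hsym : IsTransposePair (Ring.inverse Aop) (Ring.inverse Aop) := isTransposePair_inv hsymA hmul hmul
  -- `h` is supported in cell `k`
  have hhsupp : ∀ p, cellOf S hS hdivS lvl zc hcover p.1 ≠ k → h p = 0 := by
    intro p hp
    have hnot : p ∉ P := by
      rw [hP, mem_filter]; exact fun hmem => hp hmem.2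
    show (if p ∈ P then F p else 0) = 0
    rw [if_neg hnot]
  -- the duality chain: `Σ_{P} F² = ⟨h, A⁻¹D*λ⟩ = ⟨A⁻¹h, D*λ⟩ = ⟨D A⁻¹h, λ⟩`
  set LHS2 : ℝ := ∑ p ∈ P, F p ^ 2 with hLHS2
  have hLHS0 : 0 ≤ LHS2 := Finset.sum_nonneg fun p _ => sq_nonneg _
  have hdual : LHS2 = ∑ q, lam q * covD bsrc btgt c Rm ((Ring.inverse Aop) h) q := by
    calc LHS2 = ∑ p, h p * F p := by rw [hLHS2, hh]; exact (sum_indicator_mul_self P F).symm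
      _ = ∑ p, (Ring.inverse Aop) (covDT bsrc btgt c Rm lam) p * h p := by
          rw [hF]; exact Finset.sum_congr rfl fun p _ => mul_comm _ _
      _ = ∑ p, covDT bsrc btgt c Rm lam p * (Ring.inverse Aop) h p := hsym _ _
      _ = ∑ q, lam q * covD bsrc btgt c Rm ((Ring.inverse Aop) h) q := sum_covDT_mul bsrc btgt c Rm lam _
  -- restrict the last pairing to the support of `λ` and apply Cauchy–Schwarz
  set G := covD bsrc btgt c Rm ((Ring.inverse Aop) h) with hG
  set BdC := univ.filter (fun q : (UT N × Fin d) × Cp => cellOf S hS hdivS lvl zc hcover (bsrc q.1) = k') with hBdC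
  have hrestr : ∑ q, lam q * G q = ∑ q ∈ BdC, lam q * G q := by
    symm
    refine Finset.sum_subset (Finset.subset_univ BdC) fun q _ hq => ?_
    have : lam q = 0 := hlam q (fun hmem => hq (by rw [hBdC, mem_filter]; exact ⟨mem_univ _, hmem⟩))
    rw [this, zero_mul]
  set Lam2 : ℝ := ∑ q ∈ BdC, lam q ^ 2 with hLam2
  set G2 : ℝ := ∑ q ∈ BdC, G q ^ 2 with hG2
  have hLam0 : 0 ≤ Lam2 := Finset.sum_nonneg fun q _ => sq_nonneg _
  have hG20 : 0 ≤ G2 := Finset.sum_nonneg fun q _ => sq_nonneg _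
  have hcs : ∑ q ∈ BdC, lam q * G q ≤ Real.sqrt Lam2 * Real.sqrt G2 := by
    have h := Real.sum_mul_le_sqrt_mul_sqrt BdC lam G
    rw [hLam2, hG2]
    exact h
  -- the bond sums over `BdC` equal the iterated sums over `Bd × Cp`
  have hiter : ∀ (Φ : (UT N × Fin d) × Cp → ℝ), ∑ q ∈ BdC, Φ q = ∑ b ∈ Bd, ∑ i, Φ (b, i) := by
    intro Φ
    have hprod : BdC = Bd ×ˢ (univ : Finset Cp) := by
      ext q
      rw [hBdC, hBd, mem_filter, Finset.mem_product, mem_filter]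
      simp
    rw [hprod, Finset.sum_product]
  -- file 20c with source cell `k` (the support of `h`) and target bonds `Bd` (cell `k′`)
  have h20c := real_cellGrad_levelOp_inverse_le S hS hdivS lvl zc hdisj hcover Rm hRm T hT a ha ω hsupp hamax hscale c hc hcoer
    hκ0 hκ1 hμ k h hhsupp k'
  rw [← hAop, ← hμ₀] at h20c
  have hG2eq : Real.sqrt G2 = Real.sqrt (∑ b ∈ Bd, ∑ i, (covD bsrc btgt c Rm ((Ring.inverse Aop) h) (b, i)) ^ 2) := by
    rw [hG2, hiter]
  -- `‖h‖ = √LHS2`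
  have hhnorm : ∑ q ∈ univ.filter (fun q : UT N × Cp => cellOf S hS hdivS lvl zc hcover q.1 = k), h q ^ 2 = LHS2 := by
    rw [← hP, hLHS2]
    refine Finset.sum_congr rfl fun p hp => ?_
    rw [hh]; simp only; rw [if_pos hp]
  rw [hhnorm] at h20c
  -- symmetric distance
  have hdsym : sdist bsrc btgt n tk' tk = sdist bsrc btgt n tk tk' := sdist_comm bsrc btgt n tk' tk
  have hbound : Real.sqrt G2 ≤ Kc * Real.sqrt LHS2 := by
    rw [hG2eq, hKc, ← hdsym]
    exact h20c
  -- assemble: `LHS2 ≤ √Lam2·√G2 ≤ √Lam2·Kc·√LHS2` ⟹ `√LHS2 ≤ Kc·√Lam2`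
  have hmain : LHS2 ≤ Real.sqrt LHS2 * (Kc * Real.sqrt Lam2) := by
    calc LHS2 = ∑ q ∈ BdC, lam q * G q := by rw [hdual, hrestr]
      _ ≤ Real.sqrt Lam2 * Real.sqrt G2 := hcs
      _ ≤ Real.sqrt Lam2 * (Kc * Real.sqrt LHS2) := mul_le_mul_of_nonneg_left hbound (Real.sqrt_nonneg _)
      _ = Real.sqrt LHS2 * (Kc * Real.sqrt Lam2) := by ring
  have hfin : Real.sqrt LHS2 ≤ Kc * Real.sqrt Lam2 := by
    by_cases h0 : Real.sqrt LHS2 = 0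
    · rw [h0]; positivity
    · have hpos : 0 < Real.sqrt LHS2 := lt_of_le_of_ne (Real.sqrt_nonneg _) (Ne.symm h0)
      have : Real.sqrt LHS2 * Real.sqrt LHS2 ≤ Real.sqrt LHS2 * (Kc * Real.sqrt Lam2) := by
        rw [Real.mul_self_sqrt hLHS0]; exact hmain
      exact le_of_mul_le_mul_left this hpos
  have hLam2eq : Real.sqrt Lam2 = Real.sqrt (∑ b ∈ Bd, ∑ i, lam (b, i) ^ 2) := by rw [hLam2, hiter]
  rw [hLam2eq, hKc] at hfin
  exact hfin

end

end Summit.QuantumFields.BalabanUV.Beta.MultiscaleGradientL2Adjoint
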